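import Summits.Ventures.HSemireg.WedgeHankelRecurrenceGaussHermiteExample

/-!
# Venture HSemireg — **CALIBRATION: THE CHEBYSHEV RECURRENCE OF THE SECOND KIND (the free Jacobi matrix)**: the recurrence `a ≡ 0`, `b_j = 1∕4` for ALL `j ≥ 1` gives `q_n = 2^{−n} U_n`
# (Mathlib's `Polynomial.Chebyshev.U`), whose zeros in the chapter's increasing format are `cos((m+1−k)π∕(m+2))`, `k = 0, …, m` (Mathlib `roots_U_real`); it differs from the first-kind recurrence of
# N332 (`b_1 = 1∕2`) in ONE coupling, so N349 applies: the largest zero of `T_{m+1}` STRICTLY exceeds that of `U_{m+1}` — `cos(π∕(m+2)) < cos(π∕(2(m+1)))` for `m ≥ 1`, read off the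
# strict Perron monotonicity (a consistency check of §1114 against closed forms)

HONEST FRAMING. Part of the Lean index of the computation cell `pub-hsemireg` (seat p10 gen 45, Sunday typer «UNIFORM-IN-n»).  Mathlib's Chebyshev polynomials and `Real.cos` only; no variety, no
cohomology theory, no sheaf, no Ext group and no semiregularity map is constructed here; nothing here says that HC / HC_CM / HC_AV holds; no Literature fact (unproved `Prop`) is declared or used.
Custodian versions as in `WedgeHankelSiegelIdeal` (1/3).
SOURCES (cited).  G. Szegő, *Orthogonal Polynomials*, (1.12.3) and §4.1 (`U_n`, its recurrence and zeros `cos(kπ∕(n+1))`); T. S. Chihara, *An Introduction to Orthogonal Polynomials* (1978) Ch. I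
Ex. 4.3 ∕ Ch. V §2 (the constant-coefficient recurrence); T. J. Rivlin, *Chebyshev Polynomials* (2nd ed.) §1.2.
PROOF TYPED HERE.  Two-step induction with Mathlib's `U_add_two`; the nodes by `U_real_cos` (`U_n(cos θ) sin θ = sin((n+1)θ)`); uniqueness of the increasing zero vector (N279
`eq_prod_X_sub_C_of_monic_of_roots`); the comparison by N349 `top_zero_strictMono_offdiag` applied to the two recurrences built from their coefficients.
DEDUP DISCLOSURE (`rg -n 'Chebyshev.U|chebyshevU' Summits/Ventures/HSemireg`, 2026-09-03): N342 uses `U` at the `T`-nodes for the Favard weights; the second-kind recurrence itself is not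
identified anywhere.  The 6 names below: 0 hits tree-wide.

WHAT IS IN THE TREE.  N332 `chebyshev_recurrence_eq_prod`, `chebyshev_nodes_strictMono`; N349 `top_zero_strictMono_offdiag`; N279 `recurrence_monic_natDegree`, `eq_prod_X_sub_C_of_monic_of_roots`;
Mathlib `Polynomial.Chebyshev.U_add_two`, `U_zero`, `U_one`, `U_real_cos`, `Real.strictAntiOn_cos`.
THIS FILE (namespace `Summit.Ventures.HSemireg.Wedge.HankelOuter` continued; CHAINED on N359 (import only); 0 definitions):
* §1125 **`chebyshevU_recurrence_eq_U`** (`q_n = 2^{−n} U_n`), `chebyshevU_nodes_strictMono` (`k ↦ cos((m+1−k)π∕(m+2))` increasing), `chebyshevU_recurrence_eval_node` (`q_{m+1}` vanishes there),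
  **`chebyshevU_recurrence_eq_prod`** (`q_{m+1} = ∏_k (X − cos((m+1−k)π∕(m+2)))`), `recurrence_of_coefficients` (a recurrence with prescribed coefficients exists),
  **`chebyshev_top_zero_T_gt_U`** (`cos(π∕(m+2)) < cos(π∕(2(m+1)))`, `m ≥ 1`, via N349).
CAVEATS.  Calibration only.  Nothing Ext-side.  New names only.
-/

open Module Polynomial Real
open scoped Matrix Polynomial

namespace Summit.Ventures.HSemireg.Wedge.HankelOuter

/-! ## §1125. The Chebyshev recurrence of the second kind -/

/-- **`q_n = 2^{−n} U_n`** for the recurrence `a ≡ 0`, `b_j = 1∕4` (`j ≥ 1`). [Szegő (1.12.3), §4.1; Chihara Ch. I Ex. 4.3; this file, §1125] -/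
theorem chebyshevU_recurrence_eq_U {q : ℕ → ℝ[X]} {a b : ℕ → ℝ} (hq0 : q 0 = 1) (hq1 : q 1 = Polynomial.X - C (a 0))
    (hrec : ∀ n, q (n + 2) = (Polynomial.X - C (a (n + 1))) * q (n + 1) - C (b (n + 1)) * q n) (ha : ∀ n, a n = 0) (hb : ∀ n, b (n + 1) = 1 / 4) :
    ∀ n : ℕ, q n = C ((1 / 2 : ℝ) ^ n) * Polynomial.Chebyshev.U ℝ (n : ℤ) := by
  have h : C (1 / 2 : ℝ) * (2 : ℝ[X]) = 1 := by
    rw [show (2 : ℝ[X]) = C (2 : ℝ) from (map_ofNat C 2).symm, ← map_mul]; norm_num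
  have hq : C (1 / 4 : ℝ) = C (1 / 2 : ℝ) ^ 2 := by rw [← map_pow]; norm_num
  have key : ∀ n : ℕ, q n = C ((1 / 2 : ℝ) ^ n) * Polynomial.Chebyshev.U ℝ (n : ℤ) ∧ q (n + 1) = C ((1 / 2 : ℝ) ^ (n + 1)) * Polynomial.Chebyshev.U ℝ ((n : ℤ) + 1) := by
    intro n
    induction n with
    | zero =>
      refine ⟨by rw [hq0, pow_zero, C_1, one_mul, Nat.cast_zero, Polynomial.Chebyshev.U_zero], ?_⟩
      rw [hq1, ha 0, C_0, sub_zero, Nat.cast_zero, zero_add, zero_add, pow_one, Polynomial.Chebyshev.U_one]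
      linear_combination (-Polynomial.X) * h
    | succ n ih =>
      obtain ⟨h1, h2⟩ := ih
      refine ⟨by rw [h2]; push_cast; rfl, ?_⟩
      have hU := Polynomial.Chebyshev.U_add_two (R := ℝ) (n : ℤ)
      rw [show n + 1 + 1 = n + 2 by ring, hrec n, h2, h1, ha, hb, C_0, sub_zero]
      push_cast
      rw [show (n : ℤ) + 1 + 1 = (n : ℤ) + 2 by ring, hU, hq]
      simp only [map_pow]
      linear_combination (-(Polynomial.X * Polynomial.Chebyshev.U ℝ ((n : ℤ) + 1) * C (1 / 2 : ℝ) ^ (n + 1))) * h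
  exact fun n => (key n).1

/-- **The second-kind nodes listed increasingly: `k ↦ cos((m + 1 − k)π∕(m + 2))` is strictly increasing on `Fin (m+1)`.** [Szegő §4.1; this file, §1125] -/
theorem chebyshevU_nodes_strictMono (m : ℕ) :
    StrictMono (fun k : Fin (m + 1) => cos ((((Fin.rev k : Fin (m + 1)) : ℝ) + 1) * π / ((m : ℝ) + 2))) := by
  have hmem : ∀ k : Fin (m + 1), (((Fin.rev k : Fin (m + 1)) : ℝ) + 1) * π / ((m : ℝ) + 2) ∈ Set.Icc 0 π := fun k => by
    have hk : ((Fin.rev k : Fin (m + 1)) : ℝ) ≤ m := by exact_mod_cast Nat.lt_succ_iff.1 (Fin.rev k).is_lt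
    have hk0 : (0 : ℝ) ≤ ((Fin.rev k : Fin (m + 1)) : ℝ) := Nat.cast_nonneg _
    constructor
    · positivity
    · rw [div_le_iff₀ (by positivity)]; nlinarith [pi_pos]
  intro k l hkl
  refine strictAntiOn_cos (hmem l) (hmem k) ?_
  have h : ((Fin.rev l : Fin (m + 1)) : ℝ) < ((Fin.rev k : Fin (m + 1)) : ℝ) := by exact_mod_cast Fin.rev_lt_rev.2 hkl
  exact div_lt_div_of_pos_right (by nlinarith [pi_pos]) (by positivity)

/-- **`q_{m+1}` vanishes at the second-kind nodes** (`U_{m+1}(cos θ) sin θ = sin((m+2)θ) = sin(jπ) = 0`, `sin θ ≠ 0`). [this file, §1125] -/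
theorem chebyshevU_recurrence_eval_node {q : ℕ → ℝ[X]} {a b : ℕ → ℝ} (hq0 : q 0 = 1) (hq1 : q 1 = Polynomial.X - C (a 0))
    (hrec : ∀ n, q (n + 2) = (Polynomial.X - C (a (n + 1))) * q (n + 1) - C (b (n + 1)) * q n) (ha : ∀ n, a n = 0) (hb : ∀ n, b (n + 1) = 1 / 4)
    (m : ℕ) (k : Fin (m + 1)) :
    (q (m + 1)).eval (cos ((((Fin.rev k : Fin (m + 1)) : ℝ) + 1) * π / ((m : ℝ) + 2))) = 0 := by
  rw [chebyshevU_recurrence_eq_U hq0 hq1 hrec ha hb (m + 1), eval_mul, eval_C, mul_eq_zero]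
  right
  have hk : ((Fin.rev k : Fin (m + 1)) : ℝ) ≤ m := by exact_mod_cast Nat.lt_succ_iff.1 (Fin.rev k).is_lt
  have hk0 : (0 : ℝ) ≤ ((Fin.rev k : Fin (m + 1)) : ℝ) := Nat.cast_nonneg _
  have hsin : sin ((((Fin.rev k : Fin (m + 1)) : ℝ) + 1) * π / ((m : ℝ) + 2)) ≠ 0 := by
    refine (sin_pos_of_pos_of_lt_pi (by positivity) ?_).ne'
    rw [div_lt_iff₀ (by positivity)]; nlinarith [pi_pos]
  have h := Polynomial.Chebyshev.U_real_cos ((((Fin.rev k : Fin (m + 1)) : ℝ) + 1) * π / ((m : ℝ) + 2)) ((m + 1 : ℕ) : ℤ)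
  have hzero : sin ((((m + 1 : ℕ) : ℤ) + 1) * ((((Fin.rev k : Fin (m + 1)) : ℝ) + 1) * π / ((m : ℝ) + 2))) = 0 := by
    rw [Real.sin_eq_zero_iff]
    refine ⟨((Fin.rev k : Fin (m + 1)) : ℕ) + 1, ?_⟩
    push_cast
    field_simp
    ring
  rw [hzero] at h
  exact (mul_eq_zero.1 h).resolve_right hsin

/-- **`q_{m+1} = ∏_k (X − cos((m + 1 − k)π∕(m + 2)))`** — the zeros of `2^{−(m+1)} U_{m+1}` in the chapter's increasing product format. [Szegő §4.1; Mathlib `roots_U_real`; this file, §1125] -/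
theorem chebyshevU_recurrence_eq_prod {q : ℕ → ℝ[X]} {a b : ℕ → ℝ} (hq0 : q 0 = 1) (hq1 : q 1 = Polynomial.X - C (a 0))
    (hrec : ∀ n, q (n + 2) = (Polynomial.X - C (a (n + 1))) * q (n + 1) - C (b (n + 1)) * q n) (ha : ∀ n, a n = 0) (hb : ∀ n, b (n + 1) = 1 / 4) (m : ℕ) :
    q (m + 1) = ∏ k : Fin (m + 1), (Polynomial.X - C (cos ((((Fin.rev k : Fin (m + 1)) : ℝ) + 1) * π / ((m : ℝ) + 2)))) := by
  obtain ⟨hmo, hd⟩ := recurrence_monic_natDegree hq0 hq1 hrec (m + 1)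
  exact eq_prod_X_sub_C_of_monic_of_roots hmo hd (chebyshevU_nodes_strictMono m).injective (chebyshevU_recurrence_eval_node hq0 hq1 hrec ha hb m)

/-- **A recurrence with prescribed coefficients exists**: for any `a, b` there is `q` with `q_0 = 1`, `q_1 = X − a_0`, `q_{n+2} = (X − a_{n+1}) q_{n+1} − b_{n+1} q_n`. [bookkeeping; this file, §1125] -/
theorem recurrence_of_coefficients (a b : ℕ → ℝ) : ∃ q : ℕ → ℝ[X], q 0 = 1 ∧ q 1 = Polynomial.X - C (a 0) ∧
    ∀ n, q (n + 2) = (Polynomial.X - C (a (n + 1))) * q (n + 1) - C (b (n + 1)) * q n :=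
  ⟨fun n => (Nat.rec (motive := fun _ => ℝ[X] × ℝ[X]) (1, Polynomial.X - C (a 0))
    (fun n p => (p.2, (Polynomial.X - C (a (n + 1))) * p.2 - C (b (n + 1)) * p.1)) n).1, rfl, rfl, fun _ => rfl⟩

/-- **CONSISTENCY CHECK OF N349 AGAINST CLOSED FORMS: `cos(π∕(m+2)) < cos(π∕(2(m+1)))` for `m ≥ 1`** — the largest zero of `U_{m+1}` (coupling `b_1 = 1∕4`) is strictly below the largest zero
of `T_{m+1}` (coupling `b_1 = 1∕2`), as the strict Perron monotonicity predicts. [this file, §1125] -/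
theorem chebyshev_top_zero_T_gt_U {m : ℕ} (hm : 1 ≤ m) : cos (π / ((m : ℝ) + 2)) < cos (π / (2 * ((m : ℝ) + 1))) := by
  -- the two recurrences
  obtain ⟨q, hq0, hq1, hrec⟩ := recurrence_of_coefficients (fun _ => (0 : ℝ)) (fun _ => (1 / 4 : ℝ))
  obtain ⟨q', hq0', hq1', hrec'⟩ := recurrence_of_coefficients (fun _ => (0 : ℝ)) (fun j => if j = 1 then (1 / 2 : ℝ) else 1 / 4)
  have hx := chebyshevU_recurrence_eq_prod (a := fun _ => (0 : ℝ)) (b := fun _ => (1 / 4 : ℝ)) hq0 hq1 hrec (fun _ => rfl) (fun _ => rfl) m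
  have hy := chebyshev_recurrence_eq_prod (a := fun _ => (0 : ℝ)) (b := fun j => if j = 1 then (1 / 2 : ℝ) else 1 / 4) hq0' hq1' hrec' (fun _ => rfl) (if_pos rfl)
    (fun n => if_neg (by omega)) m
  have h := top_zero_strictMono_offdiag (a := fun _ => (0 : ℝ)) (b := fun _ => (1 / 4 : ℝ)) (b' := fun j => if j = 1 then (1 / 2 : ℝ) else 1 / 4)
    hq0 hq1 hrec hq0' hq1' hrec' (fun _ => by norm_num) (fun j => by split_ifs <;> norm_num)
    (t := m) (fun j _ _ => by split_ifs <;> norm_num) (j₀ := 1) le_rfl hm (by norm_num)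
    (chebyshevU_nodes_strictMono m) hx (chebyshev_nodes_strictMono m) hy
  simpa [Fin.rev_last] using h

end Summit.Ventures.HSemireg.Wedge.HankelOuter
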